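import Summits.CriticalPhenomena.SAWScalingLimit.Theorems.BoundaryTP2.Negative.TP2CertAllPairs4x4B
import HarnessLib

/-!
# Crux `BoundaryTP2` (stmt-CriticalPhenomena-7115): the crux holds AS TYPED on the 4 × 4 box

Certified-compute seat (refuter `ccert`), instance of `TP2CertFull`: for `Ω = rectDomain 3 3` (the open
rectangle whose discrete domain at mesh `1` is `ℤ²` induced on `{0..3} × {0..3}`) and `δ = 1`, EVERY quadruple
`(p₁,p₂,p₃,p₄)` satisfying the crux's hypotheses (i) interlacing, (ii), (iii) — interior points included —
satisfies `Z(p₁,p₃)Z(p₂,p₄) ≤ Z(p₁,p₂)Z(p₃,p₄)`, at every fugacity `x ∈ [10/27, 5/13]` for the path kernel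
(`full4x4_graphTP2`) and at `x_c` for `Z = SAW.weight Ω 1 · · univ` under the quoted bounds `2.6 ≤ μ ≤ 2.7`
(`full4x4_boundaryTP2`: literally `BoundaryTP2` specialised to this `Ω, δ`).  Kernel checks
`fcAt4x4_i` (16 first indices; per quadruple: the exact subdivision certificate, or a found disjoint
realisation of the crossing pairing refuting (i)); simulated beforehand: 5382 canonical quadruples certified
(13636 cells, depth ≤ 7), 5538 refuted by witnesses, 0 failures.  Kernel `decide` only:
axioms `propext`, `Classical.choice`, `Quot.sound`. [folklore]
-/

namespace Summit.CriticalPhenomena.SAWScalingLimit.Theorems.BoundaryTP2.Negative.Cert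

open Literature.Probability.LatticeModels Literature.Probability.RandomPlanarGeometry
open Summit.CriticalPhenomena.SAWScalingLimit.Theorems.EdgeOfPositivity.Negative
open Summit.CriticalPhenomena.SAWScalingLimit.Theorems.BoundaryTP2
open scoped ENNReal

set_option Elab.async false  -- sequential elaboration: the enumerations are memory-heavy

set_option maxHeartbeats 0 in
/-- First index `0` (site `(0, 0)`): 1339 certified, 1391 refuted. [folklore] -/
theorem fcAt4x4_0 : fullCheckAt 3 3 16 8 ctabAll4x4 0 = true := by decide +kernel

set_option maxHeartbeats 0 in
/-- First index `1` (site `(0, 1)`): 1082 certified, 1102 refuted. [folklore] -/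
theorem fcAt4x4_1 : fullCheckAt 3 3 16 8 ctabAll4x4 1 = true := by decide +kernel

set_option maxHeartbeats 0 in
/-- First index `2` (site `(0, 2)`): 847 certified, 869 refuted. [folklore] -/
theorem fcAt4x4_2 : fullCheckAt 3 3 16 8 ctabAll4x4 2 = true := by decide +kernel

set_option maxHeartbeats 0 in
/-- First index `3` (site `(0, 3)`): 646 certified, 674 refuted. [folklore] -/
theorem fcAt4x4_3 : fullCheckAt 3 3 16 8 ctabAll4x4 3 = true := by decide +kernel

set_option maxHeartbeats 0 in
/-- First index `4` (site `(1, 0)`): 492 certified, 498 refuted. [folklore] -/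
theorem fcAt4x4_4 : fullCheckAt 3 3 16 8 ctabAll4x4 4 = true := by decide +kernel

set_option maxHeartbeats 0 in
/-- First index `5` (site `(1, 1)`): 352 certified, 368 refuted. [folklore] -/
theorem fcAt4x4_5 : fullCheckAt 3 3 16 8 ctabAll4x4 5 = true := by decide +kernel

set_option maxHeartbeats 0 in
/-- First index `6` (site `(1, 2)`): 249 certified, 255 refuted. [folklore] -/
theorem fcAt4x4_6 : fullCheckAt 3 3 16 8 ctabAll4x4 6 = true := by decide +kernel

set_option maxHeartbeats 0 in
/-- First index `7` (site `(1, 3)`): 167 certified, 169 refuted. [folklore] -/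
theorem fcAt4x4_7 : fullCheckAt 3 3 16 8 ctabAll4x4 7 = true := by decide +kernel

set_option maxHeartbeats 0 in
/-- First index `8` (site `(2, 0)`): 104 certified, 106 refuted. [folklore] -/
theorem fcAt4x4_8 : fullCheckAt 3 3 16 8 ctabAll4x4 8 = true := by decide +kernel

set_option maxHeartbeats 0 in
/-- First index `9` (site `(2, 1)`): 60 certified, 60 refuted. [folklore] -/
theorem fcAt4x4_9 : fullCheckAt 3 3 16 8 ctabAll4x4 9 = true := by decide +kernel

set_option maxHeartbeats 0 in
/-- First index `10` (site `(2, 2)`): 29 certified, 31 refuted. [folklore] -/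
theorem fcAt4x4_10 : fullCheckAt 3 3 16 8 ctabAll4x4 10 = true := by decide +kernel

set_option maxHeartbeats 0 in
/-- First index `11` (site `(2, 3)`): 12 certified, 12 refuted. [folklore] -/
theorem fcAt4x4_11 : fullCheckAt 3 3 16 8 ctabAll4x4 11 = true := by decide +kernel

set_option maxHeartbeats 0 in
/-- First index `12` (site `(3, 0)`): 3 certified, 3 refuted. [folklore] -/
theorem fcAt4x4_12 : fullCheckAt 3 3 16 8 ctabAll4x4 12 = true := by decide +kernel

set_option maxHeartbeats 0 in
/-- First index `13` (site `(3, 1)`): 0 certified, 0 refuted. [folklore] -/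
theorem fcAt4x4_13 : fullCheckAt 3 3 16 8 ctabAll4x4 13 = true := by decide +kernel

set_option maxHeartbeats 0 in
/-- First index `14` (site `(3, 2)`): 0 certified, 0 refuted. [folklore] -/
theorem fcAt4x4_14 : fullCheckAt 3 3 16 8 ctabAll4x4 14 = true := by decide +kernel

set_option maxHeartbeats 0 in
/-- First index `15` (site `(3, 3)`): 0 certified, 0 refuted. [folklore] -/
theorem fcAt4x4_15 : fullCheckAt 3 3 16 8 ctabAll4x4 15 = true := by decide +kernel

/-- All first indices pass. [folklore] -/
theorem hall4x4 : ∀ i < (boxList 3 3).length, fullCheckAt 3 3 16 8 ctabAll4x4 i = true := by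
  intro i hi
  rw [boxList4x4_eq] at hi
  simp only [List.length_cons, List.length_nil] at hi
  interval_cases i
  · exact fcAt4x4_0
  · exact fcAt4x4_1
  · exact fcAt4x4_2
  · exact fcAt4x4_3
  · exact fcAt4x4_4
  · exact fcAt4x4_5
  · exact fcAt4x4_6
  · exact fcAt4x4_7
  · exact fcAt4x4_8
  · exact fcAt4x4_9
  · exact fcAt4x4_10
  · exact fcAt4x4_11
  · exact fcAt4x4_12
  · exact fcAt4x4_13
  · exact fcAt4x4_14
  · exact fcAt4x4_15

/-- **TP₂ for every admissible quadruple of the 4 × 4 box graph, `x ∈ [10/27, 5/13]`.** [folklore] -/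
theorem full4x4_graphTP2 {x : ℝ} (hlo : 10 / 27 ≤ x) (hhi : x ≤ 5 / 13) (p₁ p₂ p₃ p₄ : Site 2)
    (hI : Interlaced (boxGraph 3 3) p₁ p₂ p₃ p₄) (hD₁ : DisjointPaths (boxGraph 3 3) p₁ p₂ p₃ p₄)
    (hD₂ : DisjointPaths (boxGraph 3 3) p₁ p₄ p₂ p₃) :
    pathKernel (boxGraph 3 3) x p₁ p₃ * pathKernel (boxGraph 3 3) x p₂ p₄ ≤
      pathKernel (boxGraph 3 3) x p₁ p₂ * pathKernel (boxGraph 3 3) x p₃ p₄ :=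
  graphTP2_box_of_fullCheck hctAll4x4 hall4x4 hlo hhi p₁ p₂ p₃ p₄ hI hD₁ hD₂

/-- **`BoundaryTP2` holds for `Ω = rectDomain 3 3`, `δ = 1` (the 4 × 4 box), as typed**, under the quoted
bounds `2.6 ≤ μ ≤ 2.7`. [folklore] -/
theorem full4x4_boundaryTP2 (hμ : SAW.LawlerSchrammWerner2004SAW_connectiveConstant_bounds)
    (p₁ p₂ p₃ p₄ : Site 2)
    (hI : ∀ (P : SAW.DomainSAW (rectDomain 3 3) 1 p₁ p₃) (Q : SAW.DomainSAW (rectDomain 3 3) 1 p₂ p₄),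
      ∃ v, v ∈ P.walk.support ∧ v ∈ Q.walk.support)
    (hD₁ : ∃ (P : SAW.DomainSAW (rectDomain 3 3) 1 p₁ p₂) (Q : SAW.DomainSAW (rectDomain 3 3) 1 p₃ p₄),
      List.Disjoint P.walk.support Q.walk.support)
    (hD₂ : ∃ (P : SAW.DomainSAW (rectDomain 3 3) 1 p₁ p₄) (Q : SAW.DomainSAW (rectDomain 3 3) 1 p₂ p₃),
      List.Disjoint P.walk.support Q.walk.support) :
    SAW.weight (rectDomain 3 3) 1 p₁ p₃ Set.univ * SAW.weight (rectDomain 3 3) 1 p₂ p₄ Set.univ ≤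
      SAW.weight (rectDomain 3 3) 1 p₁ p₂ Set.univ * SAW.weight (rectDomain 3 3) 1 p₃ p₄ Set.univ :=
  boundaryTP2_box_of_fullCheck hμ hctAll4x4 hall4x4 p₁ p₂ p₃ p₄ hI hD₁ hD₂
end Summit.CriticalPhenomena.SAWScalingLimit.Theorems.BoundaryTP2.Negative.Cert
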